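import Summits.BirchSwinnertonDyer.BirchSwinnertonDyer.Theorems.PrintCf2RamifiedOffTYZQFormMonskyOdd
import Summits.BirchSwinnertonDyer.BirchSwinnertonDyer.Theorems.PrintCf2RamifiedOffTYZQFormIdentity
import HarnessLib

/-!
# Route `PrintCf2`, crux stmt-BirchSwinnertonDyer-20509 `RamifiedOffTYZOfFacts` — THE Q-FORM IDENTITY (★)₇ FOR `n ≡ 7 (mod 8)` IN g5's VOCABULARY
# (cell `bsd-print-cf2`, LEAD of 20509 g8, line `offtyz-v7`, cycle 9; kernel helpers `--supports stmt-BirchSwinnertonDyer-20509`)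

The LEAD g7 left the `n ≡ 7 (mod 8)` sector of the Galois-mover assembly conditional on exactly two inputs (crux workfile
`Cruxes/RamifiedOffTYZOfFacts/Lines/offtyz_v7_MoverAssembly.md` §6): (a) **(★)₇** — g5's Q-form identity `Q_n = q(κ_n)` in its Ω-form for
`∏ pᵢ ≡ 7 (mod 8)` with the tree's exact definitions `QForm.Omega / kappaA / kappaB` (0 failures on all 4 233 Legendre patterns with `k ≤ 4`,
instrument `omega7.py`), and (b) bit surjectivity for the full prime set. THIS FILE PROVES (a) for every `k`:

  **`qFormIdentityOmega_seven`**: for distinct odd primes `p₁, …, p_k` with `∏ pᵢ ≡ 7 (mod 8)`,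
  `Ω_n` has diagonal `κB` and `Ω_n + Ω_nᵀ = d₀𝟙ᵀ + 𝟙d₀ᵀ` off the diagonal (`d₀ = κA + κB`),

the verbatim analogue of g6's `qFormIdentityOmega` (`…QFormIdentity`, `∏ pᵢ ≡ 5 (mod 8)`). The re-indexing steps: on an admissible block
`S` (`d_S ≡ 5 (8)`) `blockRho p S = κ^{aᵀ}(S)` (g6, even block), and for its co-block (`n/d_S ≡ 3 (8)`, `Σ y = 1`)
`coblockWeight p S = det M_{n/d_S} = det bigN aᵀ (univ∖S) y z 0` (`coblockWeight_eq_det_bigN_zero`, from `det M = det Ñ` of `…QFormMonskyOdd` on the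
sub-tuple); then (★b)₇/(★a)₇ of `…QFormMonskyOdd`. Proof of (★)₇ as a whole: `…QFormOddForest` (parity, (★b)₇), `…QFormOddForestPair` ((★a)₇),
`…QFormMonskyOdd` (Monsky bridge `Ñ = L·M_n·R`), this file. CONSEQUENCE (g7 §6, paper level): with (b), every square-free `n ≡ 7 (mod 8)` with
`#Sel₂(E_n) = 8` and `q(κ_n) ≠ 0` (i.e. `κB ≠ 0` or `κA + κB` non-constant) has a Galois mover of its genus point, hence `𝓛(n)` odd,
`ord_{s=1} L(E_n,s) = rank E_n(ℚ) = 1`, `Ш(E_n)[2^∞] = 0`, `BSD(E_n, 2)` — modulo TYZ 2017 §3 as displayed. Pure linear algebra over `𝔽₂` +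
quadratic reciprocity; no `sorry`. BSD is not proved by any of this; no class is closed.

References: [cite: HeathBrown1994SelmerCongruentII, Appendix (Monsky), typescript p. 39 L10 – p. 40 L31]; [cite: Smith2016CongruentDensity, §2];
[cite: Chaiken1982, §2]; [cite: TianYuanZhang2017, Thm. 1.1, §3.1, Thm. 3.5].
-/

namespace Summit.BirchSwinnertonDyer.PrintCf2.QFormForest

open Matrix Finset Literature.LinearAlgebra.Matrix Literature.Combinatorics.Enumerative
open Literature.NumberTheory.EllipticCurves.Smith2016

section SevenBlocks

open Literature.NumberTheory.EllipticCurves.HeathBrown1994 Literature.NumberTheory.EllipticCurves.MonskySelmerParity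
open Summit.BirchSwinnertonDyer.PrintCf2.QForm

variable {k : ℕ} (p : Fin k → ℕ) (hp : ∀ i, (p i).Prime) (hp2 : ∀ i, p i ≠ 2) (hinj : Function.Injective p)

include hp hp2 hinj in
/-- **`coblockWeight p S = det bigN aᵀ (univ ∖ S) y z 0`** for a co-block with `Σ_{univ∖S} (−1/pᵢ)₊ = 1` (e.g. `S` admissible in `n ≡ 7 (mod 8)`,
co-block `n/d_S ≡ 3 (mod 8)`): Monsky's matrix of the co-block sub-tuple has the determinant of its doubled matrix without root weights
(`det_monskyMatrixOdd_eq_det_bigN_zero` on the sub-tuple), which re-indexes to the ambient block (`det_bigN_eq_det_bigN_reindex`).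
[cite: HeathBrown1994SelmerCongruentII, Appendix (Monsky), typescript p. 39 L27–L33] [cite: Chaiken1982, §2] -/
theorem coblockWeight_eq_det_bigN_zero (S : Finset (Fin k)) (hy : ∑ i ∈ Sᶜ, addLegendreSym (-1) (p i) = 1) :
    coblockWeight p S =
      (bigN (fun i j => legendreMatrix p j i) Sᶜ (fun i => addLegendreSym (-1) (p i)) (fun i => addLegendreSym 2 (p i)) 0).det := by
  set e := (Sᶜ.orderIsoOfFin rfl).toEquiv with he
  set q : Fin Sᶜ.card → ℕ := blockPrimes p Sᶜ with hq
  have hqe : ∀ t, q t = p (e t : Fin k) := fun t => rfl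
  have hqp : ∀ t, (q t).Prime := fun t => hp _
  have hq2 : ∀ t, q t ≠ 2 := fun t => hp2 _
  have hqinj : Function.Injective q := fun s t hst => e.injective (Subtype.ext (hinj hst))
  have hyq : ∑ t, addLegendreSym (-1) (q t) = 1 := by
    rw [← hy]
    simp only [hqe]
    rw [← sum_coe_sort Sᶜ]
    exact e.sum_comp (fun x : {x // x ∈ Sᶜ} => addLegendreSym (-1) (p (x : Fin k)))
  rw [coblockWeight, coblockMonsky, ← hq, det_monskyMatrixOdd_eq_det_bigN_zero q hqp hq2 hqinj hyq,
    det_bigN_eq_det_bigN_reindex _ Sᶜ _ _ _ e]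
  congr 1
  refine bigN_congr_offdiag (fun i j hij => ?_) _ _ _ _
  rw [Families.legendreMatrix_apply_of_ne q hij.symm,
    Families.legendreMatrix_apply_of_ne p (fun h => hij.symm (e.injective (Subtype.ext h))), hqe, hqe]

include hp hp2 hinj in
/-- The summand dictionary on an admissible block of `n ≡ 7 (mod 8)`:
`coblockWeight p S · blockRho p S t = [t ∈ S] · κ_t^{aᵀ}(S) · det bigN aᵀ(univ∖S) y z 0` (the block is even: `blockRho = κ^{aᵀ}` by g6; the
co-block is odd: `coblockWeight = det Ñ`). [cite: HeathBrown1994SelmerCongruentII, Appendix (Monsky), typescript p. 39 L27–L41] [cite: Chaiken1982, §2] -/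
theorem coblockWeight_mul_blockRho_seven (h7 : (∏ i, p i) % 8 = 7) {S : Finset (Fin k)} (hS : (∏ i ∈ S, p i) % 8 = 5) (t : Fin k) :
    coblockWeight p S * blockRho p S t =
      if t ∈ S then treeDet (fun i j => legendreMatrix p j i) S t *
        (bigN (fun i j => legendreMatrix p j i) (univ \ S) (fun i => addLegendreSym (-1) (p i)) (fun i => addLegendreSym 2 (p i))
          0).det else 0 := by
  obtain ⟨h4, _⟩ := sums_of_prod_mod_eight_seven p hp hp2 h7
  have hyS : ∑ i ∈ S, addLegendreSym (-1) (p i) = 0 := ((admissible_iff_prod_mod_eight p hp hp2 S).mpr hS).1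
  have hyc : ∑ i ∈ Sᶜ, addLegendreSym (-1) (p i) = 1 := by
    have h := sum_add_sum_compl S (fun i => addLegendreSym (-1) (p i))
    rw [h4, hyS, zero_add] at h
    exact h
  rw [coblockWeight_eq_det_bigN_zero p hp hp2 hinj S hyc, blockRho_eq_treeDet p hp hp2 hinj S hyS t, compl_eq_univ_sdiff]
  split_ifs <;> ring

include hp hp2 hinj in
/-- **(★)₇ in Ω-form, DIAGONAL part**: for distinct odd primes with `∏ pᵢ ≡ 7 (mod 8)` and every `i`, `QForm.Omega p i i = QForm.kappaB p i`.
[cite: HeathBrown1994SelmerCongruentII, Appendix (Monsky), typescript p. 39 L10–L41] [cite: Smith2016CongruentDensity, §2] [cite: Chaiken1982, §2] -/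
theorem omega_diag_eq_kappaB_seven (h7 : (∏ i, p i) % 8 = 7) (i : Fin k) : Omega p i i = kappaB p i := by
  rw [kappaB, kappa, QForm.kerSum, kerSum_monsky_inr_eq_sum_mod_eight_seven p hp hp2 hinj h7 i, Omega, Matrix.of_apply,
    Finset.powerset_univ]
  have hL : ∀ S ∈ (univ : Finset (Finset (Fin k))).filter (fun S => admissible p S),
      coblockWeight p S * blockRho p S i * (if i ∈ S then (1 : ZMod 2) else 0) =
        if i ∈ S then treeDet (fun i j => legendreMatrix p j i) S i *
          (bigN (fun i j => legendreMatrix p j i) (univ \ S) (fun i => addLegendreSym (-1) (p i)) (fun i => addLegendreSym 2 (p i))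
            0).det else 0 := by
    intro S hS
    rw [mem_filter] at hS
    rw [coblockWeight_mul_blockRho_seven p hp hp2 hinj h7 ((admissible_eq_true_iff p S).mp hS.2) i]
    split_ifs <;> simp
  rw [sum_congr rfl hL, ← sum_filter, filter_filter]
  exact sum_congr (filter_congr fun S _ => by rw [admissible_eq_true_iff]; tauto) fun _ _ => rfl

include hp hp2 hinj in
/-- **(★)₇ in Ω-form, OFF-DIAGONAL part**: for `i ≠ j`, `QForm.Omega p i j + QForm.Omega p j i = (kappaA p i + kappaB p i) + (kappaA p j + kappaB p j)`.
[cite: HeathBrown1994SelmerCongruentII, Appendix (Monsky), typescript p. 39 L10–L41] [cite: Smith2016CongruentDensity, §2] [cite: Chaiken1982, §2] -/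
theorem omega_offdiag_eq_seven (h7 : (∏ i, p i) % 8 = 7) {i j : Fin k} (hij : i ≠ j) :
    Omega p i j + Omega p j i = (kappaA p i + kappaB p i) + (kappaA p j + kappaB p j) := by
  rw [kappaA, kappaB, kappaA, kappaB, kappa, QForm.kerSum, kerSum_monsky_four_eq_sum_mod_eight_seven p hp hp2 hinj h7 hij, Omega,
    Matrix.of_apply, Matrix.of_apply, Finset.powerset_univ, ← sum_add_distrib]
  have hL : ∀ S ∈ (univ : Finset (Finset (Fin k))).filter (fun S => admissible p S),
      coblockWeight p S * blockRho p S i * (if j ∈ S then (1 : ZMod 2) else 0) +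
        coblockWeight p S * blockRho p S j * (if i ∈ S then (1 : ZMod 2) else 0) =
        if i ∈ S ∧ j ∈ S then (treeDet (fun i j => legendreMatrix p j i) S i + treeDet (fun i j => legendreMatrix p j i) S j) *
          (bigN (fun i j => legendreMatrix p j i) (univ \ S) (fun i => addLegendreSym (-1) (p i)) (fun i => addLegendreSym 2 (p i))
            0).det else 0 := by
    intro S hS
    rw [mem_filter] at hS
    have hS5 := (admissible_eq_true_iff p S).mp hS.2
    rw [coblockWeight_mul_blockRho_seven p hp hp2 hinj h7 hS5 i, coblockWeight_mul_blockRho_seven p hp hp2 hinj h7 hS5 j]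
    by_cases hi : i ∈ S <;> by_cases hj : j ∈ S <;> simp [hi, hj]
    ring
  rw [sum_congr rfl hL, ← sum_filter, filter_filter]
  exact sum_congr (filter_congr fun S _ => by rw [admissible_eq_true_iff]; tauto) fun _ _ => rfl

end SevenBlocks


section Verbatim

open Literature.NumberTheory.EllipticCurves.HeathBrown1994 Literature.NumberTheory.EllipticCurves.MonskySelmerParity
open Summit.BirchSwinnertonDyer.PrintCf2.QForm

/-- **THE Q-FORM IDENTITY (★)₇** — g5's `QFormIdentityOmega` with the residue `5` replaced by `7` (the input (a) of the LEAD g7's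
`n ≡ 7 (mod 8)` mover assembly, `Lines/offtyz_v7_MoverAssembly.md` §6): for distinct odd primes `p₁, …, p_k` with `∏ pᵢ ≡ 7 (mod 8)`,
`Ω_n` has diagonal `κB` and `Ω_n + Ω_nᵀ = d₀ 𝟙ᵀ + 𝟙 d₀ᵀ` off the diagonal (`d₀ = κA + κB`), where `κ = (κA; κB)` is the kernel sum of Monsky's
matrix and `Ω_n = Σ_{d ≡ 5 (8)} det(M_{n/d}) · ρ(N_d) · 1_dᵀ`. [cite: HeathBrown1994SelmerCongruentII, Appendix (Monsky), typescript p. 39 L10–L41]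
[cite: Smith2016CongruentDensity, §2 Thm. 2.2 and §2.2 case 5(b)] [cite: Chaiken1982, §2 (all minors matrix tree theorem)] -/
theorem qFormIdentityOmega_seven : ∀ (k : ℕ) (p : Fin k → ℕ), (∀ i, (p i).Prime) → (∀ i, Odd (p i)) → Function.Injective p →
    (∏ i, p i) % 8 = 7 →
      (∀ i, Omega p i i = kappaB p i) ∧
      (∀ i j, i ≠ j → Omega p i j + Omega p j i = (kappaA p i + kappaB p i) + (kappaA p j + kappaB p j)) := by
  intro k p hp hodd hinj h7
  have hp2 : ∀ i, p i ≠ 2 := ne_two_of_odd p hodd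
  exact ⟨fun i => omega_diag_eq_kappaB_seven p hp hp2 hinj h7 i, fun i j hij => omega_offdiag_eq_seven p hp hp2 hinj h7 hij⟩

/-- **(★) for BOTH odd residues**: for distinct odd primes with `∏ pᵢ ≡ 5 (mod 8)` OR `∏ pᵢ ≡ 7 (mod 8)`, the Ω-form of `Q_n = q(κ_n)`
(g6's `qFormIdentityOmega` and `qFormIdentityOmega_seven` together). [cite: HeathBrown1994SelmerCongruentII, Appendix (Monsky), typescript p. 39 L10–L41]
[cite: Smith2016CongruentDensity, §2] [cite: Chaiken1982, §2] -/
theorem qFormIdentityOmega_odd : ∀ (k : ℕ) (p : Fin k → ℕ), (∀ i, (p i).Prime) → (∀ i, Odd (p i)) → Function.Injective p →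
    ((∏ i, p i) % 8 = 5 ∨ (∏ i, p i) % 8 = 7) →
      (∀ i, Omega p i i = kappaB p i) ∧
      (∀ i j, i ≠ j → Omega p i j + Omega p j i = (kappaA p i + kappaB p i) + (kappaA p j + kappaB p j)) := by
  intro k p hp hodd hinj h57
  rcases h57 with h5 | h7
  · exact qFormIdentityOmega k p hp hodd hinj h5
  · exact qFormIdentityOmega_seven k p hp hodd hinj h7

end Verbatim

end Summit.BirchSwinnertonDyer.PrintCf2.QFormForest
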